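import Literature.MathematicalPhysics.QuantumFieldTheory.Volkov2020.AppendixExactnessExample
import Literature.MathematicalPhysics.QuantumFieldTheory.Volkov2020.ProjectorTreeExchange
import HarnessLib

/-!
# Volkov 2020 (NPB 961, 115232) Appendix: **LEMMA 3.9's FACTOR ALONG THE PRINTED RAY IS EXACTLY 1/Λ** — the upper-bound half of «If we take a sufficiently big Λ, then the "naive" asymptotics for the terms corresponding to |P| = 1 will dominate over the other terms asymptotics»: on Fig. 2's crossed two-loop graph along z = (Λδ, δ², δ², δ², ∼1, Λδ²), the right-hand side of (3.11) — max_{i∈Ph(E(G))} z′_i/max(z′_i, z_i), the factor by which Lemma 3.9 suppresses the P = ∅ term below the naive asymptotics — equals 1/Λ for every Λ ≥ 1 and 0 < δ ≤ 1/(4Λ²) (the outer photon contributes Λδ/z₅ ≤ 1/Λ, the inner photon exactly 1/Λ), hence tends to 1/Λ as δ → 0⁺ and to 0 as Λ → ∞, PROVED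

independent recomputation; certified where stated, statistical where stated; no new-physics claim.

CITATION HEADER (venture `QEDPrecision`, cell `pub-qed`, track TROPICAL seat V3b = `pub-qed-trop-v3-lit-2` gen 12; VALUE-FREE: closed forms along one
printed ray of one printed example graph — nothing of X352, nothing per word). Composes `Volkov2020.AppendixExactnessExample` (B.36: Fig. 2's edge list
`edge`, its photons (0,3), (1,4) = lines 5, 6, the printed `ray`) with `Volkov2020.ProjectorTreeExchange` (B.31/B.38: z′_i = `lineMax z (LPath i)`
AS PRINTED, the (3.11) factor z′_i/max(z′_i, z_i)). Serves `tropical/view/V3-VOLKOV-DEGREES.md` §B (B.45/B.46's remaining ✗ «the FIRST dominance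
sentence of the Appendix»: its Lemma-3.9 half becomes ✓ in the quantified form below; the lower-bound half — that the |P| = 1 terms do attain
their naive asymptotics, «the most difficult task is to demonstrate that the asymptotics is not cancelled» — stays with B.36/B.37's closed forms
and is NOT claimed here).

Source. [Volkov2020] S. Volkov, "Infrared and ultraviolet power counting on the mass shell in quantum electrodynamics", Nucl. Phys. B 961
(2020) 115232 = arXiv:1912.04885v4 (e-print tex `iclos_arxiv.tex`, sha256 8613757ca2360833…, held by the cell under
`pub-qed-trop-v3-lit-2/sources/arxiv-1912.04885/`; numbering by section = the journal's), VERBATIM: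
* Appendix (journal p.18–19; tex l.631–635): "For this graph we will use the following values of Feynman parameters: z₁ = Λδ, z₂ = z₃ = z₄ = δ²,
  z₅ ∼ 1, z₆ = Λδ², where δ → 0, for the constant Λ we take some sufficiently big value."
* (tex l.647–653): "We have terms that potentially can have the asymptotics min(z₁,…,z₆)^{1/2}/(z₁…z₆) ≍ 1/δ⁸ for P = {∅}, P = {{2,3}}, P = {{2,4}},
  P = {{3,4}} (we have M = 2 − |P| in (2.7)). The most difficult task is to demonstrate that the asymptotics is not cancelled in some way. If we
  take a sufficiently big Λ, then the "naive" asymptotics for the terms corresponding to |P| = 1 will dominate over the other terms asymptotics."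
* Lemma 3.9 (journal p.16; tex l.525–531): "If |P| = 0, then … |Σ_{j:P_j=P}[𝒫Π_j]Y_j(z)| ≤ C · max_{i∈Ph(E(G))} z′_i/max(z′_i, z_i), (3.11)";
  Lemma 3.4 (p.12; tex l.366–368): "z′_i = max_{l∈LPath(i)} z_l"; §2.1 (p.7; tex l.166–167): "by LPath(i) we denote the set of all lines that are
  on the lepton path connecting the vertexes incident to i".

READING (flagged). Lines 0-based as in B.36: lepton lines 0,…,3 = printed 1,…,4 along the path 0 → 1 → 2 → 3 → 4; photon 4 = printed line 5 = edge
(0,3), so LPath(5) = {printed 1, 2, 3} = `{0, 1, 2}`; photon 5 = printed line 6 = edge (1,4), LPath(6) = {printed 2, 3, 4} = `{1, 2, 3}` (read off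
B.36's `edge`; `lpath`, `photons` below). The «other terms» dominated for big Λ are read as the P = ∅ term, whose bound (3.11) carries the extra
factor `factor39 z` := max_{i∈{5,6}} z′_i/max(z′_i, z_i) relative to the naive asymptotics shared by all four P's (tex l.647–651); the file
certifies the size of that factor along the ray and nothing about the |P| = 1 terms' actual size.

WHAT THE KERNEL CERTIFIES (all PROVED; Mathlib + B.36 + B.31/B.38 only; no named fact, D-0026 net debt 0):
* `lpath`, `photons` (AS PRINTED for Fig. 2), `factor39` (the right-hand side factor of (3.11) for this graph);
* `lineMax_outer` (z′₅ = max(z₁, z₂, z₃)), `lineMax_inner` (z′₆ = max(z₂, z₃, z₄)), `factor39_eq` (the two-photon maximum written out);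
* along the ray, for 1 ≤ Λ, 0 < δ ≤ 1/(4Λ²): `ray4_ge_half` (z₅ ≥ ½), `lineMax_outer_ray` (z′₅ = Λδ), `lineMax_inner_ray` (z′₆ = δ²),
  `term_outer_ray` (z′₅/max(z′₅, z₅) = Λδ/z₅ ≤ 1/Λ), `term_inner_ray` (z′₆/max(z′₆, z₆) = 1/Λ EXACTLY),
  **`factor39_ray` : factor39 (ray Λ δ) = 1/Λ**;
* `factor39_ray_tendsto` (→ 1/Λ as δ → 0⁺, eventually constant) and `inv_tendsto_zero` (1/Λ → 0 as Λ → ∞) — «sufficiently big Λ».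
NOT claimed: that the |P| = 1 terms attain the naive asymptotics 1/δ⁸ (non-cancellation — B.36/B.37 give the printed closed forms D, W, B_{jk},
F_{jk} but no lower bound on 𝒫[F_{jk}] is formed here), the |P| = 2 term, the constant C of (3.11) for this graph, anything per word; nothing of X352.
-/

namespace Literature.MathematicalPhysics.QuantumFieldTheory.Volkov2020

namespace AppendixExample

open Finset Filter Topology

noncomputable section

/-! ## §1 LPath and the (3.11) factor for Fig. 2 -/

/-- **LPath AS PRINTED for the two photons of Fig. 2**: photon 4 (printed 5, edge (0,3)) ↦ lepton lines {0,1,2}; photon 5 (printed 6, edge (1,4))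
↦ {1,2,3}; lepton lines ↦ ∅. [cite: Volkov2020, §2.1 «LPath(i)» (journal p.7; arXiv:1912.04885v4 tex l.166–167); Appendix Fig. 2 (p.18)] -/
def lpath (i : Fin 6) : Finset (Fin 6) :=
  if i = 4 then {0, 1, 2} else if i = 5 then {1, 2, 3} else ∅

/-- Ph(E(G)) = {4, 5} (printed lines 5, 6). [cite: Volkov2020, Appendix (journal p.18–19; arXiv:1912.04885v4 tex l.631–634)] -/
def photons : Finset (Fin 6) := {4, 5}

/-- Ph(E(G)) ≠ ∅. [cite: Volkov2020, Appendix (journal p.18–19; arXiv:1912.04885v4 tex l.631–634)] -/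
theorem photons_nonempty : photons.Nonempty := ⟨4, by simp [photons]⟩

/-- **The right-hand side factor of (3.11) for Fig. 2**: max_{i∈Ph} z′_i/max(z′_i, z_i) with z′_i = `lineMax z (lpath i)` (B.38's reading of Lemma 3.4).
[cite: Volkov2020, Lemma 3.9 eq. (3.11) (journal p.16; arXiv:1912.04885v4 tex l.525–531)] -/
def factor39 (z : Fin 6 → ℝ) : ℝ :=
  photons.sup' photons_nonempty fun i => lineMax z (lpath i) / max (lineMax z (lpath i)) (z i)

/-- z′ of a three-line path {a, b, c} is max(z_a, z_b, z_c). [cite: Volkov2020, Lemma 3.4 «z′_i = max_{l∈LPath(i)} z_l» (journal p.12; arXiv:1912.04885v4 tex l.366–368)] -/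
private theorem lineMax_three (z : Fin 6 → ℝ) (a b c : Fin 6) :
    lineMax z ({a, b, c} : Finset (Fin 6)) = max (z a) (max (z b) (z c)) := by
  have hne : ({a, b, c} : Finset (Fin 6)).Nonempty := ⟨a, by simp⟩
  refine le_antisymm ?_ (max_le (le_lineMax z (by simp)) (max_le (le_lineMax z (by simp)) (le_lineMax z (by simp))))
  obtain ⟨k, hk, e⟩ := exists_lineMax_eq z hne
  rw [e]
  simp only [mem_insert, mem_singleton] at hk
  rcases hk with rfl | rfl | rfl
  · exact le_max_left _ _
  · exact (le_max_left _ _).trans (le_max_right _ _)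
  · exact (le_max_right _ _).trans (le_max_right _ _)

/-- z′₅ = max(z₁, z₂, z₃) (0-based: lines 0, 1, 2). [cite: Volkov2020, Lemma 3.4 (journal p.12; arXiv:1912.04885v4 tex l.366–368); Appendix Fig. 2] -/
theorem lineMax_outer (z : Fin 6 → ℝ) : lineMax z (lpath 4) = max (z 0) (max (z 1) (z 2)) := by
  rw [show lpath 4 = {0, 1, 2} by simp [lpath]]
  exact lineMax_three z 0 1 2

/-- z′₆ = max(z₂, z₃, z₄) (0-based: lines 1, 2, 3). [cite: Volkov2020, Lemma 3.4 (journal p.12; arXiv:1912.04885v4 tex l.366–368); Appendix Fig. 2] -/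
theorem lineMax_inner (z : Fin 6 → ℝ) : lineMax z (lpath 5) = max (z 1) (max (z 2) (z 3)) := by
  rw [show lpath 5 = {1, 2, 3} by simp [lpath]]
  exact lineMax_three z 1 2 3

/-- The factor written out over the two photons. [cite: Volkov2020, Lemma 3.9 eq. (3.11) (journal p.16; arXiv:1912.04885v4 tex l.525–531)] -/
theorem factor39_eq (z : Fin 6 → ℝ) :
    factor39 z = max (lineMax z (lpath 4) / max (lineMax z (lpath 4)) (z 4)) (lineMax z (lpath 5) / max (lineMax z (lpath 5)) (z 5)) := by
  unfold factor39
  refine le_antisymm (sup'_le _ _ fun i hi => ?_)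
    (max_le (le_sup' (fun i => lineMax z (lpath i) / max (lineMax z (lpath i)) (z i)) (by simp [photons]))
      (le_sup' (fun i => lineMax z (lpath i) / max (lineMax z (lpath i)) (z i)) (by simp [photons])))
  simp only [photons, mem_insert, mem_singleton] at hi
  rcases hi with rfl | rfl
  · exact le_max_left _ _
  · exact le_max_right _ _

/-! ## §2 Along the printed ray: the factor is exactly 1/Λ -/

section Ray

variable {Λ δ : ℝ}

/-- z₅ ≥ ½ for Λ ≥ 1, 0 < δ ≤ 1/(4Λ²) («z₅ ∼ 1»). [cite: Volkov2020, Appendix «z₅ ∼ 1» (journal p.19; arXiv:1912.04885v4 tex l.633)] -/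
theorem ray4_ge_half (hΛ : 1 ≤ Λ) (hδ : 0 < δ) (hδ' : δ ≤ 1 / (4 * Λ ^ 2)) : 1 / 2 ≤ ray Λ δ 4 := by
  rw [ray_4]
  have hΛ0 : 0 < Λ := by linarith
  have h1 : Λ * δ ≤ 1 / 4 := by
    calc Λ * δ ≤ Λ * (1 / (4 * Λ ^ 2)) := mul_le_mul_of_nonneg_left hδ' hΛ0.le
      _ = 1 / (4 * Λ) := by field_simp
      _ ≤ 1 / 4 := by
          rw [div_le_div_iff₀ (by positivity) (by norm_num)]
          linarith
  have h2 : δ ≤ 1 / 4 := by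
    calc δ ≤ 1 / (4 * Λ ^ 2) := hδ'
      _ ≤ 1 / 4 := by
          rw [div_le_div_iff₀ (by positivity) (by norm_num)]
          nlinarith
  nlinarith [mul_nonneg hΛ0.le hδ.le]

/-- z′₅ = Λδ along the ray (Λδ ≥ δ²). [cite: Volkov2020, Appendix (journal p.19; arXiv:1912.04885v4 tex l.633); Lemma 3.4 (p.12)] -/
theorem lineMax_outer_ray (hΛ : 1 ≤ Λ) (hδ : 0 < δ) (hδ' : δ ≤ 1 / (4 * Λ ^ 2)) : lineMax (ray Λ δ) (lpath 4) = Λ * δ := by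
  rw [lineMax_outer, ray_0, ray_1, ray_2, max_self]
  refine max_eq_left ?_
  have h2 : δ ≤ 1 / 4 := hδ'.trans (by rw [div_le_div_iff₀ (by positivity) (by norm_num)]; nlinarith)
  nlinarith

/-- z′₆ = δ² along the ray. [cite: Volkov2020, Appendix (journal p.19; arXiv:1912.04885v4 tex l.633); Lemma 3.4 (p.12)] -/
theorem lineMax_inner_ray (Λ δ : ℝ) : lineMax (ray Λ δ) (lpath 5) = δ ^ 2 := by
  rw [lineMax_inner, ray_1, ray_2, ray_3, max_self, max_self]

/-- **The outer photon's term**: z′₅/max(z′₅, z₅) = Λδ/z₅ ≤ 1/Λ along the ray (Λ ≥ 1, 0 < δ ≤ 1/(4Λ²)).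
[cite: Volkov2020, Lemma 3.9 eq. (3.11) (journal p.16); Appendix «sufficiently big Λ» (p.19; arXiv:1912.04885v4 tex l.653)] -/
theorem term_outer_ray (hΛ : 1 ≤ Λ) (hδ : 0 < δ) (hδ' : δ ≤ 1 / (4 * Λ ^ 2)) :
    lineMax (ray Λ δ) (lpath 4) / max (lineMax (ray Λ δ) (lpath 4)) (ray Λ δ 4) = Λ * δ / ray Λ δ 4 ∧
      Λ * δ / ray Λ δ 4 ≤ 1 / Λ := by
  have hΛ0 : 0 < Λ := by linarith
  have h5 := ray4_ge_half hΛ hδ hδ'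
  have hΛδ : Λ * δ ≤ 1 / (4 * Λ) := by
    calc Λ * δ ≤ Λ * (1 / (4 * Λ ^ 2)) := mul_le_mul_of_nonneg_left hδ' hΛ0.le
      _ = 1 / (4 * Λ) := by field_simp
  have hle : Λ * δ ≤ ray Λ δ 4 := by
    calc Λ * δ ≤ 1 / (4 * Λ) := hΛδ
      _ ≤ 1 / 2 := by rw [div_le_div_iff₀ (by positivity) (by norm_num)]; linarith
      _ ≤ ray Λ δ 4 := h5
  rw [lineMax_outer_ray hΛ hδ hδ', max_eq_right hle]
  refine ⟨rfl, ?_⟩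
  rw [div_le_div_iff₀ (by linarith) hΛ0]
  calc Λ * δ * Λ = Λ ^ 2 * δ := by ring
    _ ≤ Λ ^ 2 * (1 / (4 * Λ ^ 2)) := mul_le_mul_of_nonneg_left hδ' (by positivity)
    _ = 1 / 4 := by field_simp
    _ ≤ 1 * ray Λ δ 4 := by linarith

/-- **The inner photon's term is EXACTLY 1/Λ**: z′₆/max(z′₆, z₆) = δ²/max(δ², Λδ²) = 1/Λ (Λ ≥ 1, δ > 0).
[cite: Volkov2020, Lemma 3.9 eq. (3.11) (journal p.16); Appendix (p.19; arXiv:1912.04885v4 tex l.633, l.653)] -/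
theorem term_inner_ray (hΛ : 1 ≤ Λ) (hδ : 0 < δ) :
    lineMax (ray Λ δ) (lpath 5) / max (lineMax (ray Λ δ) (lpath 5)) (ray Λ δ 5) = 1 / Λ := by
  rw [lineMax_inner_ray, ray_5, max_eq_right (by nlinarith [sq_nonneg δ])]
  have hδ2 : 0 < δ ^ 2 := by positivity
  field_simp

/-- **LEMMA 3.9's FACTOR ALONG THE PRINTED RAY = 1/Λ** (Λ ≥ 1, 0 < δ ≤ 1/(4Λ²)): the P = ∅ term is suppressed below the naive asymptotics by
exactly 1/Λ — «sufficiently big Λ». [cite: Volkov2020, Appendix «If we take a sufficiently big Λ, then the "naive" asymptotics for the terms corresponding to |P| = 1 will dominate over the other terms asymptotics» (journal p.19; arXiv:1912.04885v4 tex l.653); Lemma 3.9 eq. (3.11) (p.16; tex l.525–531)] -/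
theorem factor39_ray (hΛ : 1 ≤ Λ) (hδ : 0 < δ) (hδ' : δ ≤ 1 / (4 * Λ ^ 2)) : factor39 (ray Λ δ) = 1 / Λ := by
  obtain ⟨e, hle⟩ := term_outer_ray hΛ hδ hδ'
  rw [factor39_eq, e, term_inner_ray hΛ hδ]
  exact max_eq_right hle

/-- … hence the factor tends to 1/Λ as δ → 0⁺ (it is eventually constant). [cite: Volkov2020, Appendix «δ → 0» (journal p.19; arXiv:1912.04885v4 tex l.633–635)] -/
theorem factor39_ray_tendsto (hΛ : 1 ≤ Λ) : Tendsto (fun δ => factor39 (ray Λ δ)) (𝓝[>] 0) (𝓝 (1 / Λ)) := by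
  have hpos : 0 < 1 / (4 * Λ ^ 2) := by positivity
  refine (tendsto_const_nhds (x := 1 / Λ)).congr' ?_
  filter_upwards [Ioo_mem_nhdsGT hpos] with δ hδ
  exact (factor39_ray hΛ hδ.1 hδ.2.le).symm

/-- … and 1/Λ → 0 as Λ → ∞ («for the constant Λ we take some sufficiently big value»). [cite: Volkov2020, Appendix (journal p.19; arXiv:1912.04885v4 tex l.633–635, l.653)] -/
theorem inv_tendsto_zero : Tendsto (fun Λ : ℝ => 1 / Λ) atTop (𝓝 0) := by
  simpa only [one_div] using tendsto_inv_atTop_zero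

end Ray

end

end AppendixExample

end Literature.MathematicalPhysics.QuantumFieldTheory.Volkov2020
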